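import Mathlib.RingTheory.AlgebraicIndependent.Transcendental
import Mathlib.GroupTheory.OrderOfElement
import Literature.NumberTheory.Transcendental.OneMotiveToric
import Literature.NumberTheory.Transcendental.LindemannWeierstrassProofs
import HarnessLib

/-!
# Toric 1-motives: status of the generalised period conjecture, and its known cases

Topic `Literature/NumberTheory/Transcendental`; companion ("Proofs") file of
`Literature.NumberTheory.Transcendental.OneMotiveToric` (unit
`provefact-Literature.Periods.ToricPeriodConjecture`).

`Literature.NumberTheory.Transcendental.ToricPeriodConjecture` is André's generalised period conjecture `(CPG)_K` for the
1-motives without abelian part `M = [ℤʳ → 𝔾ₘⁿ]` (Bertolin 2002, p. 205: "Conjecture des périodes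
généralisée pour les 1-motifs (André)"; §3). It is an **open conjecture, not a theorem**: the only
result the source proves about it is Bertolin 2002, Cor. 1.3 (p. 207, proof §3.5, p. 214) — it is
*equivalent to Schanuel's conjecture* — and that equivalence is already proved, sorry-free, as
`Literature.NumberTheory.Transcendental.toricPeriodConjecture_iff_schanuel_holds`. Hence no
`ToricPeriodConjecture_holds` can be written short of proving Schanuel's conjecture, and none is
claimed here. This file records exactly the cases of the conjecture that *are* theorems:

* no torus (`n = 0`): `OneMotiveToric.gpc_of_eq_zero` (definitions file; `dim Gal_mot = 0`);
* **torsion case** `OneMotiveToric.gpc_of_isOfFinOrder`: if every `u i j` is a root of unity then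
  every period is a rational multiple of `2πi` (Huber–Wüstholz 2022, proof of Cor. 10.2), so
  `dim Gal_mot(M) ≤ 1` and the conjecture for `M` is Grothendieck's period conjecture for the Tate
  motive `ℚ(1)`, i.e. the transcendence of the period `2πi` — Lindemann 1882 (Huber–Wüstholz 2022,
  Cor. 10.1), available as `Literature.NumberTheory.Transcendental.transcendental_pi_holds`;
* the degenerate base case `OneMotiveToric.gpc_of_motGaloisDim_le_trdeg`
  (`trdeg_ℚ k ≥ dim Gal_mot(M)` already);
* conditionally on Schanuel: `OneMotiveToric.gpc_of_schanuel` (definitions file).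

Also `OneMotiveToric.one_le_trdeg_periodField`: for `n ≠ 0` the first unit of the conjectured
inequality is unconditional (`2πi ∈ k(periods(M))` is transcendental).

The next case, `M = [ℤ → 𝔾ₘ]` over `ℚ` with `u(1) = 2` (periods `2πi` and the `log 2 + 2πiℤ`,
`dim Gal_mot = 2`), asserts the algebraic independence of `π` and `log 2` and is open.

## References

* C. Bertolin, *Périodes de 1-motifs et transcendance*, J. Number Theory 97 (2002) 204–221:
  p. 205 `(CPG)_K`, Cor. 1.3 (p. 207), Lemme 3.2, Prop. 3.4, §3.5.
* A. Huber, G. Wüstholz, *Transcendence and linear relations of 1-periods*, Cambridge Tracts 227,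
  CUP 2022: Cor. 10.1 (Lindemann: `2πi` is transcendental), Cor. 10.2 and its proof (logarithms of
  roots of unity are rational multiples of `2πi`).
* F. Lindemann, *Über die Zahl π*, Math. Ann. 20 (1882).
-/

noncomputable section

open Complex Cardinal

namespace Literature.NumberTheory.Transcendental

/-- **Lindemann 1882**: the period `2πi` of `𝔾ₘ` is transcendental over `ℚ` (from the
transcendence of `π`, `transcendental_pi_holds`: if `2πi` were algebraic, so would be
`π = -(2πi · i)/2`). [cite: HuberWustholz2022, Cor. 10.1] -/
theorem transcendental_two_pi_I : Transcendental ℚ (2 * Real.pi * I : ℂ) := by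
  intro h
  have hI : IsAlgebraic ℚ Complex.I := by
    refine ⟨Polynomial.X ^ 2 + 1, Polynomial.Monic.ne_zero (by monicity!), ?_⟩
    simp
  have h2 : IsAlgebraic ℚ ((-2 : ℤ) : ℂ)⁻¹ := (isAlgebraic_int (-2)).inv
  have hpi : IsAlgebraic ℚ (Real.pi : ℂ) := by
    have e : (Real.pi : ℂ) = 2 * Real.pi * I * I * ((-2 : ℤ) : ℂ)⁻¹ := by
      rw [mul_assoc (2 * (Real.pi : ℂ)), Complex.I_mul_I]
      push_cast
      ring
    rw [e]
    exact (h.mul hI).mul h2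
  exact transcendental_pi_holds
    ((isAlgebraic_algebraMap_iff (A := ℂ) Complex.ofReal_injective).mp hpi)

namespace OneMotiveToric

variable {k : IntermediateField ℚ ℂ} {r n : ℕ} (M : OneMotiveToric k r n)

/-- **Degenerate base case of the generalised period conjecture**: if the base field `k` alone has
transcendence degree `≥ dim Gal_mot(M)` over `ℚ`, the conjectured inequality
`trdeg_ℚ k(periods(M)) ≥ dim Gal_mot(M)` holds because `k ⊆ k(periods(M))`. [folklore] -/
theorem gpc_of_motGaloisDim_le_trdeg (h : (M.motGaloisDim : Cardinal) ≤ Algebra.trdeg ℚ k) :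
    M.GPC :=
  h.trans (trdeg_mono M.le_periodField)

/-- With a non-trivial torus (`n ≠ 0`) the period field `k(periods(M))` contains the transcendental
number `2πi`, so `trdeg_ℚ k(periods(M)) ≥ 1` unconditionally (Lindemann).
[cite: HuberWustholz2022, Cor. 10.1] -/
theorem one_le_trdeg_periodField (hn : n ≠ 0) : 1 ≤ Algebra.trdeg ℚ M.periodField := by
  have hmem : (2 * Real.pi * I : ℂ) ∈ M.periodField :=
    M.periodSet_subset_periodField (M.two_pi_I_mem_periodSet hn)
  have hx : Transcendental ℚ (⟨2 * Real.pi * I, hmem⟩ : M.periodField) :=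
    (transcendental_algebraMap_iff (R := ℚ) (A := ℂ)
      (algebraMap M.periodField ℂ).injective).mp transcendental_two_pi_I
  have hai := (algebraicIndependent_iff_transcendental.mpr hx).cardinalMk_le_trdeg
  simpa using hai

/-- If every `u i j` is a root of unity, every period of `M` is a rational multiple of `2πi`:
a logarithm `ℓ` of an `m`-th root of unity satisfies `exp (m ℓ) = 1`, so `m ℓ ∈ 2πiℤ`.
[cite: HuberWustholz2022, Cor. 10.2 (proof)] -/
theorem periodSet_subset_span_of_isOfFinOrder (h : ∀ i j, IsOfFinOrder (M.u i j)) :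
    M.periodSet ⊆ Submodule.span ℚ {(2 * Real.pi * I : ℂ)} := by
  rintro p (⟨-, rfl⟩ | ⟨i, j, hp⟩)
  · exact Submodule.subset_span rfl
  · obtain ⟨m, hm, hm1⟩ := isOfFinOrder_iff_pow_eq_one.1 (h i j)
    have h1 : cexp (m * p) = 1 := by rw [Complex.exp_nat_mul, hp, hm1]
    obtain ⟨N, hN⟩ := Complex.exp_eq_one_iff.1 h1
    have hm0 : (m : ℂ) ≠ 0 := Nat.cast_ne_zero.2 hm.ne'
    refine Submodule.mem_span_singleton.2 ⟨(N : ℚ) / m, ?_⟩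
    rw [← Rat.cast_smul_eq_qsmul (R := ℂ), smul_eq_mul]
    push_cast
    rw [div_mul_eq_mul_div, ← hN, mul_div_cancel_left₀ _ hm0]

/-- If every `u i j` is a root of unity then `dim Gal_mot(M) ≤ 1` (`= dim 𝔾ₘ`; the unipotent
radical is trivial). [cite: Bertolin2002, Prop. 3.4] -/
theorem motGaloisDim_le_one_of_isOfFinOrder (h : ∀ i j, IsOfFinOrder (M.u i j)) :
    M.motGaloisDim ≤ 1 := by
  have hle : Submodule.span ℚ M.periodSet ≤ Submodule.span ℚ {(2 * Real.pi * I : ℂ)} :=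
    Submodule.span_le.2 (M.periodSet_subset_span_of_isOfFinOrder h)
  haveI : Module.Finite ℚ (Submodule.span ℚ ({(2 * Real.pi * I : ℂ)} : Set ℂ)) :=
    Module.Finite.span_of_finite ℚ (Set.finite_singleton _)
  calc M.motGaloisDim ≤ Module.finrank ℚ (Submodule.span ℚ ({(2 * Real.pi * I : ℂ)} : Set ℂ)) :=
        Submodule.finrank_mono hle
    _ ≤ ({(2 * Real.pi * I : ℂ)} : Set ℂ).toFinset.card := finrank_span_le_card _
    _ = 1 := by simp

/-- **The generalised period conjecture holds for toric 1-motives with torsion `u`** (all `u i j`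
roots of unity, i.e. `M` isogenous to `[ℤʳ → 0] ⊕ [0 → 𝔾ₘⁿ]`): then `dim Gal_mot(M) ≤ 1` and
`k(periods(M)) ∋ 2πi` has transcendence degree `≥ 1` by Lindemann — the conjecture for `M` is the
(known) period conjecture for the Tate motive `ℚ(1)`. [cite: HuberWustholz2022, Cor. 10.1] -/
theorem gpc_of_isOfFinOrder (h : ∀ i j, IsOfFinOrder (M.u i j)) : M.GPC := by
  rcases eq_or_ne n 0 with hn | hn
  · exact M.gpc_of_eq_zero hn
  · unfold GPC
    calc (M.motGaloisDim : Cardinal) ≤ (1 : ℕ) :=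
          Nat.cast_le.2 (M.motGaloisDim_le_one_of_isOfFinOrder h)
      _ = 1 := Nat.cast_one
      _ ≤ Algebra.trdeg ℚ M.periodField := M.one_le_trdeg_periodField hn

/-- In particular the conjecture holds for the split 1-motive `[0 : ℤʳ → 𝔾ₘⁿ]` (`u ≡ 1`), e.g. for
`𝔾ₘ` itself: `trdeg_ℚ k(2πi) ≥ 1 = dim 𝔾ₘ`. [cite: HuberWustholz2022, Cor. 10.1] -/
theorem gpc_of_u_eq_one (h : ∀ i j, M.u i j = 1) : M.GPC :=
  M.gpc_of_isOfFinOrder fun i j => by rw [h i j]; exact IsOfFinOrder.one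

end OneMotiveToric

end Literature.NumberTheory.Transcendental

end
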